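import Literature.AlgebraicGeometry.Resolution.ImmediateRationalUniformization
import Mathlib.FieldTheory.IsSepClosed
import Mathlib.RingTheory.Polynomial.SeparableDegree
import HarnessLib

/-!
# Kaplansky's condition (3) over a separably closed field (Knaf–Kuhlmann 2009, Lemma 2.16)

Topic: `Literature/AlgebraicGeometry/Resolution`. A PROVED leaf in the decomposition of the named
fact `KnafKuhlmann2009_Prop310_sepClosed` (Knaf–Kuhlmann 2009, Prop. 3.10 over a
separable-algebraically closed ground field; `KnafKuhlmann2009Thm11Parts.lean`), whose printed
proof (p. 14 of the arXiv PDF) reads: Thm. 3.8 (henselian rationality) ⇒ `F ⊆ K(x)^h`;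
"Since `(K,P)` is separably tame and hence separable-algebraically maximal, Lemma 2.16 shows that
condition (3) holds in `(K(x)|K,P)`. Therefore `P|_{K(x)}` is strongly smoothly
`O_K`-uniformizable by Lemma 3.9"; Lemma 3.7; Cor. 3.6. Lemma 3.9 is proved in
`ImmediateRationalUniformization.lean` with condition (3) as a hypothesis (`h3`); this file PROVES
condition (3) in the case the decomposition needs, `K` separably closed:

* `kaplansky_condition_of_isSepClosed` — **Lemma 2.16 for separably closed `K`**: if `K(z)|K` is
  immediate with `z` transcendental over `K`, then for every polynomial `g` over `K` the value
  `v g(a)` is constant for `a ∈ K` close enough to `z`.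

Lemma 2.16 as printed ("Assume that `(K,P)` is a separable-algebraically maximal field or that
`(K(z),P)` lies in the completion of `(K,P)`") is proved in the paper through Kaplansky's theory
of immediate algebraic extensions and a variant of the continuity of roots ([K6]); a separably
closed field is separable-algebraically maximal for every valuation (it has no proper separable
algebraic extension). The proof given here for that case is elementary and direct:

* `eventuallyConst_mul`, `eventuallyConst_C`, `eventuallyConst_sub` — closure of "eventually
  constant value" under products; constants; linear factors `X - d` (by Lemma 2.5 =
  `exists_valuation_sub_lt`: the values `v(z - a)` have no minimum).
* `eventuallyConst_pow_sub` — the factors `X^q - d`, `q = p^m ≥ p`: with `w := z^q`,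
  `a^q - d = (a - z)^q + (w - d)`; either `v(z - a₀)^q < v(w - d)` for some `a₀ ∈ K`, and then
  `v(a^q - d) = v(w - d)` near `z`, or `v(z - a)^q > v(w - d)` for all `a ∈ K`, which is absurd:
  the polynomial `s = X^q - eX - d` over `K` (`e ∈ K^×`, `v(ez) < v(w - d)`, using that `v` is
  non-trivial on `K`) is separable, hence splits in `K`, and `v(s(z)) = v(w - d)` while also
  `v(s(z)) = ∏ⱼ v(z - rⱼ) > v(w - d)` over its `q` roots `rⱼ ∈ K`.
* `eventuallyConst_of_irreducible` — an irreducible polynomial over the separably closed `K` is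
  `c₁ X^{p^m} + c₀` (separable contraction of degree `1`), reducing to the two cases above.
* the main theorem: `v` is non-trivial on `K` (an immediate `K(z)` with `z ∉ K` cannot exist over
  a trivially valued `K`), and induction over an irreducible factorization of `g`.

## Source

* H. Knaf, F.-V. Kuhlmann, *Every place admits local uniformization in a finite extension of
  the function field*, Adv. Math. 221 (2009) 428–453 = arXiv:math/0702856: Lemma 2.5 (p. 8),
  Lemma 2.16 (p. 10), proof of Prop. 3.10 (p. 14). Pages of the 19-page arXiv PDF.

## Rendering notes

As in `ImmediateRationalUniformization.lean`: `(Ω, V)` a valued field, `K : Subfield Ω`,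
`K(z) = Subfield.closure (K ∪ {z})`; "`z` transcendental over `K`" ↦ no non-zero polynomial over
`Ω` with coefficients in `K` vanishes at `z`; "`K(z)|K` immediate" ↦ the hypotheses `hval`, `hres`
of Lemma 3.9; condition (3) ↦ the hypothesis `h3` of Lemma 3.9 (balls
`{a ∈ K : v(z - a) ≥ v(z - a₀)}`; values multiplicative, so the paper's `≥` is `≤`).
-/

noncomputable section

namespace Literature.AlgebraicGeometry.Resolution

universe u

open Polynomial

variable {Ω : Type u} [Field Ω] (V : ValuationSubring Ω) (K : Subfield Ω)

/-! ## Eventually constant values: closure properties -/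

/-- Products: if `v f(a)` and `v g(a)` are constant on balls around `z`, so is `v (fg)(a)` (on the
smaller ball). [folklore] -/
theorem eventuallyConst_mul {z : Ω} {f g : Polynomial Ω}
    (hf : ∃ a₀ ∈ K, ∃ α : V.ValueGroup, ∀ a ∈ K, V.valuation (z - a) ≤ V.valuation (z - a₀) →
      V.valuation (f.eval a) = α)
    (hg : ∃ a₀ ∈ K, ∃ α : V.ValueGroup, ∀ a ∈ K, V.valuation (z - a) ≤ V.valuation (z - a₀) →
      V.valuation (g.eval a) = α) :
    ∃ a₀ ∈ K, ∃ α : V.ValueGroup, ∀ a ∈ K, V.valuation (z - a) ≤ V.valuation (z - a₀) →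
      V.valuation ((f * g).eval a) = α := by
  obtain ⟨a₁, ha₁, α₁, h₁⟩ := hf
  obtain ⟨a₂, ha₂, α₂, h₂⟩ := hg
  rcases le_total (V.valuation (z - a₁)) (V.valuation (z - a₂)) with h | h
  · refine ⟨a₁, ha₁, α₁ * α₂, fun a ha hle => ?_⟩
    rw [eval_mul, map_mul, h₁ a ha hle, h₂ a ha (hle.trans h)]
  · refine ⟨a₂, ha₂, α₁ * α₂, fun a ha hle => ?_⟩
    rw [eval_mul, map_mul, h₁ a ha (hle.trans h), h₂ a ha hle]

/-- Constants have constant value. [folklore] -/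
theorem eventuallyConst_C {z : Ω} (c : Ω) :
    ∃ a₀ ∈ K, ∃ α : V.ValueGroup, ∀ a ∈ K, V.valuation (z - a) ≤ V.valuation (z - a₀) →
      V.valuation ((C c).eval a) = α :=
  ⟨0, K.zero_mem, V.valuation c, fun a _ _ => by rw [eval_C]⟩

/-! ## Linear factors -/

/-- For `d ∈ K` the value `v(a - d)` is constant (`= v(z - d)`) for `a ∈ K` close to `z`: the
values `v(z - a)`, `a ∈ K`, have no minimum (Lemma 2.5), so some `a₀ ∈ K` is closer to `z` than
`d`. [folklore] -/
theorem eventuallyConst_sub {z : Ω} (hzK : z ∉ K)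
    (hval : ∀ w ∈ Subfield.closure ((K : Set Ω) ∪ {z}), w ≠ 0 → ∃ b ∈ K,
      V.valuation w = V.valuation b)
    (hres : ∀ w ∈ Subfield.closure ((K : Set Ω) ∪ {z}), w ∈ V → ∃ c ∈ K,
      V.valuation (w - c) < 1)
    {d : Ω} (hd : d ∈ K) :
    ∃ a₀ ∈ K, ∃ α : V.ValueGroup, ∀ a ∈ K, V.valuation (z - a) ≤ V.valuation (z - a₀) →
      V.valuation (a - d) = α := by
  obtain ⟨a₀, ha₀, hlt⟩ := exists_valuation_sub_lt V K hzK hval hres hd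
  refine ⟨a₀, ha₀, V.valuation (z - d), fun a ha hle => ?_⟩
  have : a - d = (z - d) - (z - a) := by ring
  rw [this]
  exact Valuation.map_sub_eq_of_lt_left _ (lt_of_le_of_lt hle hlt)

/-! ## The purely inseparable factors `X^q - d` -/

/-- A product over a non-empty multiset of factors each `> β` exceeds `β ^ card`. [folklore] -/
theorem pow_card_lt_prod_map {ι : Type*} (s : Multiset ι) (hs : s ≠ 0) (f : ι → V.ValueGroup)
    (β : V.ValueGroup) (h : ∀ i ∈ s, β < f i) : β ^ Multiset.card s < (s.map f).prod := by
  induction s using Multiset.induction_on with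
  | empty => exact absurd rfl hs
  | cons i s ih =>
    rw [Multiset.card_cons, pow_succ', Multiset.map_cons, Multiset.prod_cons]
    by_cases hs0 : s = 0
    · subst hs0
      simpa using h i (Multiset.mem_cons_self i _)
    · exact mul_lt_mul'' (h i (Multiset.mem_cons_self i _))
        (ih hs0 fun j hj => h j (Multiset.mem_cons_of_mem hj)) zero_le zero_le

/-- **The heart of Lemma 2.16 over a separably closed `K`** (characteristic `p`, `q = p^m`,
`m ≥ 1`): if `K(z)|K` is immediate with `z` transcendental and `v` is non-trivial on `K`, then for
`d ∈ K` the value `v(a^q - d)` is constant for `a ∈ K` close to `z`. With `w := z^q`,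
`a^q - d = (a - z)^q + (w - d)`; if `v(z - a₀)^q < v(w - d)` for some `a₀ ∈ K` the value is
`v(w - d)` near `z`. Otherwise `v(z - a)^q > v(w - d)` for all `a ∈ K` (no minimum), and the
SEPARABLE polynomial `s = X^q - eX - d` over `K` (`e ∈ K^×` with `v(ez) < v(w - d)`) splits in
`K`: `v(s(z)) = v(w - d)` directly, but `v(s(z)) = ∏ v(z - rⱼ) > v(w - d)` over its `q` roots
`rⱼ ∈ K` — a contradiction. (The printed proof instead invokes Kaplansky's theory of immediate
algebraic extensions and [K6].) [cite: KnafKuhlmann2009, Lemma 2.16] -/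
theorem eventuallyConst_pow_sub {p : ℕ} [hp : Fact p.Prime] [CharP Ω p] [IsSepClosed K] {z : Ω}
    (htrans : ∀ P : Polynomial Ω, (∀ k, P.coeff k ∈ K) → P.eval z = 0 → P = 0)
    (hval : ∀ w ∈ Subfield.closure ((K : Set Ω) ∪ {z}), w ≠ 0 → ∃ b ∈ K,
      V.valuation w = V.valuation b)
    (hres : ∀ w ∈ Subfield.closure ((K : Set Ω) ∪ {z}), w ∈ V → ∃ c ∈ K,
      V.valuation (w - c) < 1)
    {π : Ω} (hπK : π ∈ K) (hπ0 : π ≠ 0) (hvπ : V.valuation π < 1)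
    (m : ℕ) (hm : m ≠ 0) {d : Ω} (hd : d ∈ K) :
    ∃ a₀ ∈ K, ∃ α : V.ValueGroup, ∀ a ∈ K, V.valuation (z - a) ≤ V.valuation (z - a₀) →
      V.valuation (a ^ p ^ m - d) = α := by
  classical
  set E := Subfield.closure ((K : Set Ω) ∪ {z}) with hE
  have hKE : ∀ x ∈ K, x ∈ E := fun x hx => Subfield.subset_closure (Or.inl hx)
  have hzE : z ∈ E := Subfield.subset_closure (Or.inr rfl)
  set q : ℕ := p ^ m with hqdef
  have hq0 : q ≠ 0 := pow_ne_zero m hp.out.ne_zero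
  have hqpos : 0 < q := Nat.pos_of_ne_zero hq0
  have hinj : Function.Injective (algebraMap K Ω) := (algebraMap K Ω).injective
  have hzK : z ∉ K := by
    intro hzK
    let Q : Polynomial K := X - C ⟨z, hzK⟩
    have h := htrans (Q.map (algebraMap K Ω)) (fun k => by rw [coeff_map]; exact (Q.coeff k).2)
      (by rw [eval_map, ← aeval_def]; simp only [Q, map_sub, aeval_X, aeval_C]; exact sub_self z)
    exact X_sub_C_ne_zero (⟨z, hzK⟩ : K) ((Polynomial.map_eq_zero_iff hinj).mp h)
  have hz0 : z ≠ 0 := fun h => hzK (h ▸ K.zero_mem)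
  set w : Ω := z ^ q with hwdef
  have hwd0 : w - d ≠ 0 := by
    intro hwd
    let Q : Polynomial K := X ^ q - C ⟨d, hd⟩
    have h := htrans (Q.map (algebraMap K Ω)) (fun k => by rw [coeff_map]; exact (Q.coeff k).2)
      (by
        rw [eval_map, ← aeval_def]
        simp only [Q, map_sub, map_pow, aeval_X, aeval_C]
        exact hwd)
    exact X_pow_sub_C_ne_zero hqpos (⟨d, hd⟩ : K) ((Polynomial.map_eq_zero_iff hinj).mp h)
  have hwdE : w - d ∈ E := sub_mem (pow_mem hzE q) (hKE d hd)
  by_cases h1 : ∃ a₀ ∈ K, V.valuation (z - a₀) ^ q < V.valuation (w - d)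
  · obtain ⟨a₀, ha₀, hlt⟩ := h1
    refine ⟨a₀, ha₀, V.valuation (w - d), fun a ha hle => ?_⟩
    have heq : a ^ p ^ m - d = (a - z) ^ q + (w - d) := by
      rw [hqdef, sub_pow_char_pow, hwdef, hqdef]; ring
    rw [heq, Valuation.map_add_eq_of_lt_right]
    rw [map_pow, Valuation.map_sub_swap]
    exact lt_of_le_of_lt (pow_le_pow_left₀ zero_le hle q) hlt
  · exfalso
    push Not at h1
    have hstrict : ∀ a ∈ K, V.valuation (w - d) < V.valuation (z - a) ^ q := by
      intro a ha
      obtain ⟨a', ha', hlt⟩ := exists_valuation_sub_lt V K hzK hval hres ha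
      exact lt_of_le_of_lt (h1 a' ha') (pow_lt_pow_left₀ hlt zero_le hq0)
    -- `e ∈ K^×` with `v(e z) < v(w - d)`
    obtain ⟨b, hbK, hb⟩ := hval _ hwdE hwd0
    obtain ⟨b', hb'K, hb'⟩ := hval z hzE hz0
    have hb0 : b ≠ 0 := by rintro rfl; rw [map_zero, _root_.map_eq_zero] at hb; exact hwd0 hb
    have hb'0 : b' ≠ 0 := by rintro rfl; rw [map_zero, _root_.map_eq_zero] at hb'; exact hz0 hb'
    set e : Ω := π * b / b' with hedef
    have heK : e ∈ K := div_mem (mul_mem hπK hbK) hb'K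
    have he0 : e ≠ 0 := div_ne_zero (mul_ne_zero hπ0 hb0) hb'0
    have hvez : V.valuation (e * z) < V.valuation (w - d) := by
      have hvb'0 : V.valuation b' ≠ 0 := (_root_.map_ne_zero _).mpr hb'0
      have hvb0 : (0 : V.ValueGroup) < V.valuation b := zero_lt_iff.mpr ((_root_.map_ne_zero _).mpr hb0)
      have : V.valuation (e * z) = V.valuation π * V.valuation b := by
        rw [hedef, map_mul, map_div₀, map_mul, hb', div_mul_cancel₀ _ hvb'0]
      rw [this, hb]
      calc V.valuation π * V.valuation b < 1 * V.valuation b := mul_lt_mul_of_pos_right hvπ hvb0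
        _ = V.valuation b := one_mul _
    -- the separable polynomial `s = X^q - eX - d` over `K`
    let e' : K := ⟨e, heK⟩
    let d' : K := ⟨d, hd⟩
    have he'0 : e' ≠ 0 := fun h => he0 (congrArg Subtype.val h)
    set s : Polynomial K := X ^ q - C e' * X - C d' with hsdef
    have hqK : (q : K) = 0 := by
      rw [hqdef, Nat.cast_pow, CharP.cast_eq_zero K p, zero_pow hm]
    have hders : derivative s = C (-e') := by
      rw [hsdef, derivative_sub, derivative_sub, derivative_X_pow, derivative_C, sub_zero,
        derivative_mul, derivative_C, zero_mul, derivative_X, zero_add, mul_one,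
        hqK, C_0, zero_mul, zero_sub, ← C_neg]
    have hsep : s.Separable := by
      rw [Polynomial.separable_def, hders]
      refine ⟨0, C ((-e')⁻¹), ?_⟩
      rw [zero_mul, zero_add, ← C_mul, inv_mul_cancel₀ (neg_ne_zero.mpr he'0), C_1]
    have hsplit : s.Splits := IsSepClosed.splits_of_separable s hsep
    have hmonic : s.Monic := by
      rw [hsdef, sub_sub]
      refine (monic_X_pow q).sub_of_left ?_
      refine lt_of_le_of_lt (degree_add_le _ _) (max_lt ?_ ?_)
      · refine lt_of_le_of_lt (degree_C_mul_X_le _) ?_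
        rw [degree_X_pow]
        have : 1 < q := by
          rw [hqdef]
          exact Nat.one_lt_pow hm hp.out.one_lt
        exact_mod_cast this
      · exact lt_of_le_of_lt degree_C_le (by rw [degree_X_pow]; exact_mod_cast hqpos)
    have hnat : s.natDegree = q := by
      rw [hsdef, sub_sub, natDegree_sub_eq_left_of_natDegree_lt] <;> rw [natDegree_X_pow]
      refine lt_of_le_of_lt (natDegree_add_le _ _) (max_lt ?_ ?_)
      · refine lt_of_le_of_lt ((natDegree_C_mul_le _ _).trans natDegree_X_le) ?_
        rw [hqdef]
        exact Nat.one_lt_pow hm hp.out.one_lt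
      · rw [natDegree_C]; exact hqpos
    have hcard : Multiset.card s.roots = q := by rw [splits_iff_card_roots.mp hsplit, hnat]
    have hprod := hsplit.eq_prod_roots
    rw [hmonic.leadingCoeff, C_1, one_mul] at hprod
    -- evaluate at `z` in `Ω`
    have heval : (s.map (algebraMap K Ω)).eval z = w - d - e * z := by
      rw [hsdef, Polynomial.map_sub, Polynomial.map_sub, Polynomial.map_pow, map_X,
        Polynomial.map_mul, map_C, map_X, map_C, eval_sub, eval_sub, eval_pow, eval_X, eval_mul,
        eval_C, eval_X, eval_C]
      change z ^ q - e * z - d = w - d - e * z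
      ring
    have heval' : (s.map (algebraMap K Ω)).eval z =
        (s.roots.map fun r : K => z - (r : Ω)).prod := by
      conv_lhs => rw [hprod]
      rw [Polynomial.map_multiset_prod, eval_multiset_prod, Multiset.map_map, Multiset.map_map]
      congr 1
      refine Multiset.map_congr rfl fun r _ => ?_
      simp only [Function.comp_apply, Polynomial.map_sub, map_X, map_C, eval_sub, eval_X, eval_C]
      rfl
    have hv1 : V.valuation ((s.map (algebraMap K Ω)).eval z) = V.valuation (w - d) := by
      rw [heval]
      exact Valuation.map_sub_eq_of_lt_left _ hvez
    have hv2 : V.valuation ((s.map (algebraMap K Ω)).eval z) =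
        (s.roots.map fun r : K => V.valuation (z - (r : Ω))).prod := by
      rw [heval', map_multiset_prod, Multiset.map_map]
      rfl
    have hroots0 : s.roots ≠ 0 := by
      intro h0
      rw [h0, Multiset.card_zero] at hcard
      exact hq0 hcard.symm
    have hlt : V.valuation (w - d) ^ q <
        (s.roots.map fun r : K => V.valuation (z - (r : Ω)) ^ q).prod := by
      have := pow_card_lt_prod_map V s.roots hroots0 (fun r : K => V.valuation (z - (r : Ω)) ^ q)
        (V.valuation (w - d)) fun r _ => hstrict r r.2
      rwa [hcard] at this
    rw [Multiset.prod_map_pow, ← hv2, hv1] at hlt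
    exact lt_irrefl _ hlt


/-! ## Transcendence bookkeeping -/

/-- If no non-zero polynomial over `K` vanishes at `z`, then `z ∉ K`. [folklore] -/
theorem not_mem_of_forall_eval_eq_zero {z : Ω}
    (htrans : ∀ P : Polynomial Ω, (∀ k, P.coeff k ∈ K) → P.eval z = 0 → P = 0) : z ∉ K := by
  intro hzK
  have hinj : Function.Injective (algebraMap K Ω) := (algebraMap K Ω).injective
  let Q : Polynomial K := X - C ⟨z, hzK⟩
  have h := htrans (Q.map (algebraMap K Ω)) (fun k => by rw [coeff_map]; exact (Q.coeff k).2)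
    (by rw [eval_map, ← aeval_def]; simp only [Q, map_sub, aeval_X, aeval_C]; exact sub_self z)
  exact X_sub_C_ne_zero (⟨z, hzK⟩ : K) ((Polynomial.map_eq_zero_iff hinj).mp h)

/-! ## Irreducible factors -/

/-- Over a separably closed `K`, an irreducible polynomial is `c₁ X^{p^m} + c₀`, so the value of
`i(a)` is constant near `z` by the linear case (`m = 0` or characteristic `0`) or by
`eventuallyConst_pow_sub`. [folklore] -/
theorem eventuallyConst_of_irreducible [IsSepClosed K] {z : Ω}
    (htrans : ∀ P : Polynomial Ω, (∀ k, P.coeff k ∈ K) → P.eval z = 0 → P = 0)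
    (hval : ∀ w ∈ Subfield.closure ((K : Set Ω) ∪ {z}), w ≠ 0 → ∃ b ∈ K,
      V.valuation w = V.valuation b)
    (hres : ∀ w ∈ Subfield.closure ((K : Set Ω) ∪ {z}), w ∈ V → ∃ c ∈ K,
      V.valuation (w - c) < 1)
    {π : Ω} (hπK : π ∈ K) (hπ0 : π ≠ 0) (hvπ : V.valuation π < 1)
    {i : Polynomial K} (hi : Irreducible i) :
    ∃ a₀ ∈ K, ∃ α : V.ValueGroup, ∀ a ∈ K, V.valuation (z - a) ≤ V.valuation (z - a₀) →
      V.valuation ((i.map (algebraMap K Ω)).eval a) = α := by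
  classical
  have hzK : z ∉ K := not_mem_of_forall_eval_eq_zero K htrans
  obtain ⟨p, hp⟩ := ExpChar.exists Ω
  obtain ⟨g, hgsep, m, hgi⟩ := hi.hasSeparableContraction p
  have hp0 : p ^ m ≠ 0 := pow_ne_zero m (expChar_pos Ω p).ne'
  have hgirr : Irreducible g := by
    refine of_irreducible_expand hp0 ?_
    rw [hgi]
    exact hi
  have hdeg : g.degree = 1 := IsSepClosed.degree_eq_one_of_irreducible K hgirr hgsep
  set c₁ : K := g.leadingCoeff with hc₁def
  set c₀ : K := g.coeff 0 with hc₀def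
  have hc₁ : c₁ ≠ 0 := leadingCoeff_ne_zero.mpr hgirr.ne_zero
  have hc₁Ω : (c₁ : Ω) ≠ 0 := fun h => hc₁ (Subtype.ext h)
  have hg : g = C c₁ * X + C c₀ := eq_X_add_C_of_degree_eq_one hdeg
  have hieq : i = C c₁ * X ^ (p ^ m) + C c₀ := by
    rw [← hgi, hg, map_add, map_mul, expand_C, expand_X, expand_C]
  set d : Ω := -(c₀ : Ω) / c₁ with hddef
  have hd : d ∈ K := div_mem (neg_mem c₀.2) c₁.2
  have heval : ∀ a : Ω, (i.map (algebraMap K Ω)).eval a = (c₁ : Ω) * (a ^ (p ^ m) - d) := by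
    intro a
    rw [hieq, Polynomial.map_add, Polynomial.map_mul, map_C, Polynomial.map_pow, map_X, map_C,
      eval_add, eval_mul, eval_C, eval_pow, eval_X, eval_C, hddef, mul_sub, mul_div_cancel₀ _ hc₁Ω]
    change (c₁ : Ω) * a ^ p ^ m + (c₀ : Ω) = (c₁ : Ω) * a ^ p ^ m - -(c₀ : Ω)
    ring
  have hcore : ∃ a₀ ∈ K, ∃ α : V.ValueGroup, ∀ a ∈ K, V.valuation (z - a) ≤ V.valuation (z - a₀) →
      V.valuation (a ^ (p ^ m) - d) = α := by
    by_cases hm : m = 0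
    · simp only [hm, pow_zero, pow_one]
      exact eventuallyConst_sub V K hzK hval hres hd
    · rcases hp with _ | ⟨hprime⟩
      · simp only [one_pow, pow_one]
        exact eventuallyConst_sub V K hzK hval hres hd
      · haveI : Fact p.Prime := ⟨hprime⟩
        exact eventuallyConst_pow_sub V K htrans hval hres hπK hπ0 hvπ m hm hd
  obtain ⟨a₀, ha₀, α, h⟩ := hcore
  exact ⟨a₀, ha₀, V.valuation (c₁ : Ω) * α, fun a ha hle => by rw [heval, map_mul, h a ha hle]⟩

/-! ## Lemma 2.16 over a separably closed field -/

/-- **Knaf–Kuhlmann 2009, Lemma 2.16, over a separably closed ground field** ("Let `(K(z)|K, P)`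
be an immediate transcendental extension. Assume that `(K, P)` is a separable-algebraically
maximal field […]. Then: `∀ f ∈ K[z] ∃ α, β ∈ vK ∀ a ∈ B(z, β): v f(a) = α`" — a separably
closed valued field having no proper separable-algebraic extension at all), PROVED, in the
form consumed by Lemma 3.9 (`isSmoothlyUniformizableIn_of_immediate_of_kaplansky`): for every
polynomial `g` over `K` there is a centre `a₀ ∈ K` such that `v g(a)` is constant for `a ∈ K` with
`v(z - a) ≥ v(z - a₀)`. Proof: `v` is non-trivial on `K` (an immediate `K(z) ∋ z ∉ K` is
impossible over a trivially valued `K`); factor `g` into irreducibles over `K`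
(`WfDvdMonoid.induction_on_irreducible`) and use `eventuallyConst_of_irreducible`,
`eventuallyConst_mul`. [cite: KnafKuhlmann2009, Lemma 2.16] -/
theorem kaplansky_condition_of_isSepClosed [IsSepClosed K] {z : Ω}
    (htrans : ∀ P : Polynomial Ω, (∀ k, P.coeff k ∈ K) → P.eval z = 0 → P = 0)
    (hval : ∀ w ∈ Subfield.closure ((K : Set Ω) ∪ {z}), w ≠ 0 → ∃ b ∈ K,
      V.valuation w = V.valuation b)
    (hres : ∀ w ∈ Subfield.closure ((K : Set Ω) ∪ {z}), w ∈ V → ∃ c ∈ K,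
      V.valuation (w - c) < 1) :
    ∀ g : Polynomial Ω, (∀ k, g.coeff k ∈ K) → ∃ a₀ ∈ K, ∃ α : V.ValueGroup,
      ∀ a ∈ K, V.valuation (z - a) ≤ V.valuation (z - a₀) → V.valuation (g.eval a) = α := by
  classical
  set E := Subfield.closure ((K : Set Ω) ∪ {z}) with hE
  have hKE : ∀ x ∈ K, x ∈ E := fun x hx => Subfield.subset_closure (Or.inl hx)
  have hzE : z ∈ E := Subfield.subset_closure (Or.inr rfl)
  have hzK : z ∉ K := not_mem_of_forall_eval_eq_zero K htrans
  have hz0 : z ≠ 0 := fun h => hzK (h ▸ K.zero_mem)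
  -- `v` is non-trivial on `K`
  obtain ⟨π, hπK, hπ0, hvπ⟩ : ∃ π ∈ K, π ≠ 0 ∧ V.valuation π < 1 := by
    by_contra hno
    push Not at hno
    have hK1 : ∀ c ∈ K, c ≠ 0 → V.valuation c = 1 := by
      intro c hc hc0
      have h1 : 1 ≤ V.valuation c := hno c hc hc0
      have h2 : 1 ≤ V.valuation c⁻¹ := hno c⁻¹ (inv_mem hc) (inv_ne_zero hc0)
      have h3 : V.valuation c * V.valuation c⁻¹ = 1 := by
        rw [← map_mul, mul_inv_cancel₀ hc0, map_one]
      refine le_antisymm ?_ h1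
      calc V.valuation c = V.valuation c * 1 := (mul_one _).symm
        _ ≤ V.valuation c * V.valuation c⁻¹ := mul_le_mul_right h2 _
        _ = 1 := h3
    obtain ⟨b, hbK, hb⟩ := hval z hzE hz0
    have hb0 : b ≠ 0 := by rintro rfl; rw [map_zero, _root_.map_eq_zero] at hb; exact hz0 hb
    have hzV : z ∈ V := (V.valuation_le_one_iff z).mp (by rw [hb, hK1 b hbK hb0])
    obtain ⟨c, hcK, hc⟩ := hres z hzE hzV
    have hzc0 : z - c ≠ 0 := fun h => hzK (by rw [sub_eq_zero.mp h]; exact hcK)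
    obtain ⟨b', hb'K, hb'⟩ := hval (z - c) (sub_mem hzE (hKE c hcK)) hzc0
    have hb'0 : b' ≠ 0 := by rintro rfl; rw [map_zero, _root_.map_eq_zero] at hb'; exact hzc0 hb'
    rw [hb', hK1 b' hb'K hb'0] at hc
    exact lt_irrefl _ hc
  intro g hg
  obtain ⟨g', rfl⟩ : ∃ g' : Polynomial K, g'.map (algebraMap K Ω) = g :=
    (mem_lifts g).mp ((lifts_iff_coeff_lifts g).mpr fun k => ⟨⟨g.coeff k, hg k⟩, rfl⟩)
  clear hg
  refine WfDvdMonoid.induction_on_irreducible (motive := fun f : Polynomial K =>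
    ∃ a₀ ∈ K, ∃ α : V.ValueGroup, ∀ a ∈ K, V.valuation (z - a) ≤ V.valuation (z - a₀) →
      V.valuation ((f.map (algebraMap K Ω)).eval a) = α) g' ?_ ?_ ?_
  · exact ⟨0, K.zero_mem, 0, fun a _ _ => by simp⟩
  · intro u hu
    obtain ⟨c, -, rfl⟩ := Polynomial.isUnit_iff.mp hu
    rw [map_C]
    exact eventuallyConst_C V K _
  · intro a i _ hi ih
    rw [Polynomial.map_mul]
    exact eventuallyConst_mul V K (eventuallyConst_of_irreducible V K htrans hval hres hπK hπ0 hvπ hi) ih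

end Literature.AlgebraicGeometry.Resolution

end
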